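import Literature.AlgebraicGeometry.Resolution.QuadraticTransforms
import Literature.AlgebraicGeometry.Resolution.QuadraticTransformsUFD
import HarnessLib

/-!
# Crux `Steer` (stmt-ResolutionOfSingularities-16345), chain W4.1, σ-residual SUPPORT: **CurveEscape — one step**
# (helper γ, part 1 of 2; Theses-free, def-free)

OURS (campaign `res-hironaka`, rung L ★L-G4, slot W4.1; a statement about the route's own objects — quadratic
transforms of local rings along a valuation ring (`Resolution.IsQuadraticTransformAlong`, `QuadraticTransforms.lean`);
it replaces the role of no printed item and is NOT a statement of the manuscript under review [claim: Hironaka2017,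
status: under-review]; AI review is weaker than expert review). ORDER γ of res-L0-w41-plan-1 (HOME/STATUS
2026-08-27T06:15:18Z; sketch `L/w41/Sketch-CurveEscape.lean` sha16 240ea8550b380136); seat res-type-038. Part 2
(`FrobeniusClosingSteerCurveEscape.lean`) runs these one-step facts along a sequence and proves the sketch's two `Prop`s.

## ONE STEP `R → R'` along `O` (exceptional parameter `x`: `R' = (R[𝔪_R/x])_{𝔪_O ∩ R[𝔪_R/x]}`), primes `P' ∩ R = P ≠ 𝔪_R`

* `not_mem_of_comap_eq`: **`x ∉ P'`** (else `𝔪_R = x·R' ∩ R ⊆ P' ∩ R = P`).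
* `exists_div_mem_of_mem`, `valuation_lt_of_mem`: **`u ∈ P ⇒ u/x ∈ P'`**, hence **`v u < v x`** (`O` dominates `R'`).
* `exists_sub_inclusion_mem` (LIFTING): if moreover `O` dominates `R` and `R ⧸ P` is a valuation ring (e.g. regular
  of dimension one), every `r' ∈ R'` is `≡ r (mod P')` for some `r ∈ R` — the residue ring `R' ⧸ P'` is birational
  over and dominates the valuation ring `R ⧸ P`, hence adds nothing: write `r'·s = t` with `s, t ∈ R`, `s ∉ P'`
  (clearing the powers of `x` and the unit denominator, `exists_mul_pow_eq_of_mem_blowupRing`); in `R ⧸ P` either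
  `s̄ ∣ t̄` — done — or `t̄ ∣ s̄`, `s̄ = t̄ c̄`, and then `r' c ≡ 1 (mod P')` makes `c` a unit of `R'`, hence of `R`
  (domination), so again `s̄ ∣ t̄`.

Def-free, sorry-free; imports `Resolution.QuadraticTransforms` (+ `QuadraticTransformsUFD`, carried for part 2's
`isPrincipalIdealRing_of_ringKrullDim_le_one`).
-/

noncomputable section

set_option linter.dupNamespace false

namespace Summit.ResolutionOfSingularities.ResolutionOfSingularities.Theorems.SwitchingDichotomy.CurveEscape

open IsLocalRing Literature.AlgebraicGeometry.Resolution

universe u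

variable {K : Type u} [Field K]

/-! ## §0 Elements of the blow-up ring `R[𝔪_R/x]` -/

/-- Every element of `R[𝔪_R/x]` becomes an element of `R` after multiplication by a power of `x` (copy of the
tree's `Resolution.exists_pow_mul_mem_of_mem_blowupRing`, `ArithmeticalThreefoldsLocalFrameStep.lean`, re-proved to
keep the import closure small). OURS bookkeeping. [folklore] -/
theorem exists_mul_pow_eq_of_mem_blowupRing {R : Subring K} [IsLocalRing R] {x : R} (hx0 : (x : K) ≠ 0) {y : K}
    (hy : y ∈ blowupRing R (x : K)) : ∃ (N : ℕ) (r : R), y * (x : K) ^ N = r := by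
  induction hy using Subring.closure_induction with
  | mem y hy =>
    rcases hy with hy | ⟨y, -, rfl⟩
    · exact ⟨0, ⟨y, hy⟩, by rw [pow_zero, mul_one]⟩
    · exact ⟨1, y, by rw [pow_one, div_mul_cancel₀ _ hx0]⟩
  | zero => exact ⟨0, 0, by simp⟩
  | one => exact ⟨0, 1, by simp⟩
  | add y z _ _ hy hz =>
    obtain ⟨N, r, hr⟩ := hy
    obtain ⟨M, s, hs⟩ := hz
    refine ⟨N + M, r * x ^ M + s * x ^ N, ?_⟩
    rw [Subring.coe_add, Subring.coe_mul, Subring.coe_mul, Subring.coe_pow, Subring.coe_pow, ← hr, ← hs]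
    ring
  | neg y _ hy =>
    obtain ⟨N, r, hr⟩ := hy
    exact ⟨N, -r, by rw [Subring.coe_neg, ← hr]; ring⟩
  | mul y z _ _ hy hz =>
    obtain ⟨N, r, hr⟩ := hy
    obtain ⟨M, s, hs⟩ := hz
    refine ⟨N + M, r * s, ?_⟩
    rw [Subring.coe_mul, ← hr, ← hs]
    ring

/-! ## §1 One quadratic transform `R → R'` along `O`, with primes `P' ∩ R = P`, `P ≠ 𝔪_R` -/

section OneStep

variable {O : ValuationSubring K} {R R' : Subring K} [IsLocalRing R] [IsLocalRing R']

/-- In a local subring dominated by `O`, membership in the maximal ideal is `v < 1`. OURS bookkeeping. [folklore] -/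
theorem mem_maximalIdeal_iff_valuation_lt_one (hRO : SubringDominates R O.toSubring) (a : R) :
    a ∈ maximalIdeal R ↔ O.valuation (a : K) < 1 :=
  (subringDominates_valuationSubring_iff hRO.1).mp hRO a

omit [IsLocalRing R'] in
/-- `y/x ∈ R'` for `y ∈ 𝔪_R` (`R' = (R[𝔪_R/x])_{𝔪_O ∩ R[𝔪_R/x]}`). OURS bookkeeping. [folklore] -/
theorem div_mem_of_mem_maximalIdeal {x : R} (hR' : R' = locAtCentre (blowupRing R (x : K)) O) {y : R}
    (hy : y ∈ maximalIdeal R) : (y : K) / x ∈ R' := by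
  rw [hR']
  exact le_locAtCentre _ O (div_mem_blowupRing (x : K) hy)

omit [IsLocalRing R] [IsLocalRing R'] in
/-- An ideal of `R` which is the contraction of a prime of `R'` is proper. OURS bookkeeping. [folklore] -/
theorem ne_top_of_comap_eq (h : IsQuadraticTransformAlong O R R') {P : Ideal R} {P' : Ideal R'} [P'.IsPrime]
    (hc : P'.comap (Subring.inclusion h.le) = P) : P ≠ ⊤ := by
  rw [← hc]
  exact Ideal.comap_ne_top _ (Ideal.IsPrime.ne_top ‹_›)

omit [IsLocalRing R'] in
/-- **The exceptional parameter is not on the strict transform**: if `P' ∩ R = P ≠ 𝔪_R` then `x ∉ P'` (else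
`𝔪_R = x·R' ∩ R ⊆ P' ∩ R = P`). OURS. [folklore] -/
theorem not_mem_of_comap_eq (h : IsQuadraticTransformAlong O R R') {x : R} (hx0 : x ≠ 0)
    (hR' : R' = locAtCentre (blowupRing R (x : K)) O) {P : Ideal R} {P' : Ideal R'} [P'.IsPrime]
    (hP : P ≠ maximalIdeal R) (hc : P'.comap (Subring.inclusion h.le) = P) :
    Subring.inclusion h.le x ∉ P' := by
  intro hxP
  have hx0' : (x : K) ≠ 0 := fun e => hx0 (Subtype.ext e)
  apply hP
  refine ((IsLocalRing.maximalIdeal.isMaximal R).eq_of_le (ne_top_of_comap_eq h hc) fun y hy => ?_).symm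
  rw [← hc, Ideal.mem_comap]
  have hmem : (y : K) / x ∈ R' := div_mem_of_mem_maximalIdeal hR' hy
  have heq : Subring.inclusion h.le y = Subring.inclusion h.le x * ⟨(y : K) / x, hmem⟩ := by
    apply Subtype.ext
    simp only [Subring.coe_mul, Subring.coe_inclusion]
    rw [mul_div_cancel₀ _ hx0']
  rw [heq]
  exact P'.mul_mem_right _ hxP

omit [IsLocalRing R'] in
/-- **`u ∈ P ⇒ u/x ∈ P'`** (primality of `P'` and `x ∉ P'`). OURS. [folklore] -/
theorem exists_div_mem_of_mem (h : IsQuadraticTransformAlong O R R') {x : R} (hx0 : x ≠ 0)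
    (hR' : R' = locAtCentre (blowupRing R (x : K)) O) {P : Ideal R} {P' : Ideal R'} [P'.IsPrime]
    (hP : P ≠ maximalIdeal R) (hc : P'.comap (Subring.inclusion h.le) = P) {u : R} (hu : u ∈ P) :
    ∃ w : R', (w : K) = (u : K) / x ∧ w ∈ P' := by
  have hx0' : (x : K) ≠ 0 := fun e => hx0 (Subtype.ext e)
  have hu𝔪 : u ∈ maximalIdeal R := IsLocalRing.le_maximalIdeal (ne_top_of_comap_eq h hc) hu
  have hu' : (u : K) / x ∈ R' := div_mem_of_mem_maximalIdeal hR' hu𝔪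
  refine ⟨⟨(u : K) / x, hu'⟩, rfl, ?_⟩
  have hincl : Subring.inclusion h.le u ∈ P' := by
    rw [← Ideal.mem_comap, hc]
    exact hu
  have heq : Subring.inclusion h.le u = Subring.inclusion h.le x * ⟨(u : K) / x, hu'⟩ := by
    apply Subtype.ext
    simp only [Subring.coe_mul, Subring.coe_inclusion]
    rw [mul_div_cancel₀ _ hx0']
  rw [heq] at hincl
  exact (Ideal.IsPrime.mem_or_mem ‹_› hincl).resolve_left (not_mem_of_comap_eq h hx0 hR' hP hc)

/-- **`u ∈ P ⇒ v u < v x`**: `u/x` lies in `P' ⊆ 𝔪_{R'}`, and `O` dominates `R'`. OURS. [folklore] -/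
theorem valuation_lt_of_mem (h : IsQuadraticTransformAlong O R R') {x : R} (hx0 : x ≠ 0)
    (hR' : R' = locAtCentre (blowupRing R (x : K)) O) {P : Ideal R} {P' : Ideal R'} [P'.IsPrime]
    (hP : P ≠ maximalIdeal R) (hc : P'.comap (Subring.inclusion h.le) = P) {u : R} (hu : u ∈ P) :
    O.valuation (u : K) < O.valuation (x : K) := by
  have hx0' : (x : K) ≠ 0 := fun e => hx0 (Subtype.ext e)
  obtain ⟨w, hw, hwP⟩ := exists_div_mem_of_mem h hx0 hR' hP hc hu
  have hlt : O.valuation (w : K) < 1 :=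
    (mem_maximalIdeal_iff_valuation_lt_one h.dominated w).mp
      (IsLocalRing.le_maximalIdeal (Ideal.IsPrime.ne_top ‹_›) hwP)
  rw [hw, map_div₀, div_lt_one₀ (pos_iff_ne_zero.mpr ((map_ne_zero _).mpr hx0'))] at hlt
  exact hlt

omit [IsLocalRing R] in
/-- An element of `R'` of value `1` is a unit of `R'` (domination by `O`). OURS bookkeeping. [folklore] -/
theorem isUnit_of_valuation_eq_one (h : IsQuadraticTransformAlong O R R') {z : R'}
    (hz : O.valuation (z : K) = 1) : IsUnit z := by
  by_contra hnu
  have hmem : z ∈ maximalIdeal R' := (IsLocalRing.mem_maximalIdeal _).mpr hnu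
  have hlt := (mem_maximalIdeal_iff_valuation_lt_one h.dominated z).mp hmem
  rw [hz] at hlt
  exact lt_irrefl _ hlt

/-- **Lifting modulo the strict transform.** If `O` dominates `R` and `R ⧸ P` is a valuation ring, then every
`r' ∈ R'` is congruent modulo `P'` to an element of `R` (the residue ring `R' ⧸ P'` is birational over and
dominates the valuation ring `R ⧸ P`, hence equals it). OURS. [folklore] -/
theorem exists_sub_inclusion_mem (h : IsQuadraticTransformAlong O R R') (hRO : SubringDominates R O.toSubring)
    {x : R} (hx0 : x ≠ 0) (hR' : R' = locAtCentre (blowupRing R (x : K)) O) {P : Ideal R} {P' : Ideal R'}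
    [P.IsPrime] [P'.IsPrime] (hP : P ≠ maximalIdeal R) (hc : P'.comap (Subring.inclusion h.le) = P)
    [ValuationRing (R ⧸ P)] (r' : R') :
    ∃ r : R, r' - Subring.inclusion h.le r ∈ P' := by
  classical
  have hx0' : (x : K) ≠ 0 := fun e => hx0 (Subtype.ext e)
  -- `r' = y / z`, `y, z ∈ R[𝔪/x]`, `v z = 1`
  have hr' : (r' : K) ∈ locAtCentre (blowupRing R (x : K)) O := hR' ▸ r'.2
  obtain ⟨y, hy, z, hz, hvz, hyz⟩ := mem_locAtCentre_iff.mp hr'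
  obtain ⟨N, a, ha⟩ := exists_mul_pow_eq_of_mem_blowupRing hx0' hy
  obtain ⟨M, b, hb⟩ := exists_mul_pow_eq_of_mem_blowupRing hx0' hz
  have hz0 : z ≠ 0 := ne_zero_of_valuation_eq_one hvz
  -- `r' · s = t` with `s := b·x^N`, `t := a·x^M` in `R`
  have hst : (r' : K) * ((b : K) * (x : K) ^ N) = (a : K) * (x : K) ^ M := by
    rw [← ha, ← hb, hyz]
    field_simp
  -- `s ∉ P`
  have hzR' : z ∈ R' := hR' ▸ le_locAtCentre _ O hz
  have hzunit : IsUnit (⟨z, hzR'⟩ : R') := isUnit_of_valuation_eq_one h hvz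
  have hsP : (b * x ^ N : R) ∉ P := by
    intro hs
    have h1 : Subring.inclusion h.le (b * x ^ N) ∈ P' := by
      rw [← Ideal.mem_comap, hc]
      exact hs
    have h2 : Subring.inclusion h.le (b * x ^ N) = ⟨z, hzR'⟩ * (Subring.inclusion h.le x) ^ (M + N) := by
      apply Subtype.ext
      simp only [Subring.coe_mul, Subring.coe_pow, Subring.coe_inclusion]
      rw [← hb]
      ring
    rw [h2] at h1
    rcases Ideal.IsPrime.mem_or_mem ‹_› h1 with h3 | h3
    · exact Ideal.IsPrime.ne_top ‹_› (Ideal.eq_top_of_isUnit_mem _ h3 hzunit)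
    · exact not_mem_of_comap_eq h hx0 hR' hP hc (Ideal.IsPrime.mem_of_pow_mem ‹_› _ h3)
  -- if `s c ≡ t (mod P)` then `r' ≡ c (mod P')`
  have key : ∀ c : R, b * x ^ N * c - a * x ^ M ∈ P → r' - Subring.inclusion h.le c ∈ P' := by
    intro c hcP
    have h1 : Subring.inclusion h.le (b * x ^ N * c - a * x ^ M) ∈ P' := by
      rw [← Ideal.mem_comap, hc]
      exact hcP
    have h2 : Subring.inclusion h.le (b * x ^ N * c - a * x ^ M) =
        Subring.inclusion h.le (b * x ^ N) * (Subring.inclusion h.le c - r') := by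
      apply Subtype.ext
      push_cast [Subring.coe_inclusion]
      rw [← hst]
      ring
    rw [h2] at h1
    rcases Ideal.IsPrime.mem_or_mem ‹_› h1 with h3 | h3
    · rw [← Ideal.mem_comap, hc] at h3
      exact absurd h3 hsP
    · have h4 := P'.neg_mem h3
      rwa [neg_sub] at h4
  -- total divisibility in the valuation ring `R ⧸ P`
  obtain ⟨cbar, hcbar⟩ :=
    PreValuationRing.cond (Ideal.Quotient.mk P (b * x ^ N)) (Ideal.Quotient.mk P (a * x ^ M))
  obtain ⟨c, rfl⟩ := Ideal.Quotient.mk_surjective cbar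
  rcases hcbar with h1 | h1
  · refine ⟨c, key c ?_⟩
    rw [← map_mul, Ideal.Quotient.eq] at h1
    exact h1
  · -- `t c ≡ s`: then `r' c ≡ 1 (mod P')`, so `c` is a unit of `R'`, hence of `R`
    rw [← map_mul, Ideal.Quotient.eq] at h1
    have h2 : Subring.inclusion h.le (a * x ^ M * c - b * x ^ N) ∈ P' := by
      rw [← Ideal.mem_comap, hc]
      exact h1
    have h3 : Subring.inclusion h.le (a * x ^ M * c - b * x ^ N) =
        Subring.inclusion h.le (b * x ^ N) * (r' * Subring.inclusion h.le c - 1) := by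
      apply Subtype.ext
      push_cast [Subring.coe_inclusion]
      rw [← hst]
      ring
    rw [h3] at h2
    rcases Ideal.IsPrime.mem_or_mem ‹_› h2 with h4 | h4
    · rw [← Ideal.mem_comap, hc] at h4
      exact absurd h4 hsP
    · have h5 : IsUnit (r' * Subring.inclusion h.le c) := by
        apply IsLocalRing.isUnit_of_mem_nonunits_one_sub_self
        have h6 : (1 : R') - r' * Subring.inclusion h.le c = -(r' * Subring.inclusion h.le c - 1) := by ring
        rw [h6]
        exact (IsLocalRing.mem_maximalIdeal _).mp
          (IsLocalRing.le_maximalIdeal (Ideal.IsPrime.ne_top ‹_›) (P'.neg_mem h4))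
      have h6 : IsUnit (Subring.inclusion h.le c) := isUnit_of_mul_isUnit_right h5
      have h7 : IsUnit c := by
        rw [isUnit_subring_iff_inv_mem] at h6 ⊢
        exact ⟨h6.1, (hRO.of_le_of_le h.le h.target_le).2 _ c.2 h6.2⟩
      obtain ⟨cu, hcu⟩ := h7
      refine ⟨((cu⁻¹ : Rˣ) : R), key _ ?_⟩
      have h8 : b * x ^ N * ((cu⁻¹ : Rˣ) : R) - a * x ^ M =
          (a * x ^ M * c - b * x ^ N) * (-((cu⁻¹ : Rˣ) : R)) := by
        rw [← hcu, sub_mul, mul_neg, mul_neg, mul_assoc (a * x ^ M), Units.mul_inv, mul_one]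
        ring
      rw [h8]
      exact P.mul_mem_right _ h1

end OneStep

end Summit.ResolutionOfSingularities.ResolutionOfSingularities.Theorems.SwitchingDichotomy.CurveEscape

end
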